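import Summits.HodgeConjecture.HodgeConjecture.Theorems.Ring2AbelianAllAndreSpreadLift
import HarnessLib

/-!
# Ring 2 · sub-cell AbelianAll (ALL ABELIAN VARIETIES), André axis, part XIX-c — THE LIFT IN LATTICE FORM FROM `HC` OF
# THE FIBRES: granted the classical curve-base spreading (part XIX-a's hypothesis shape `SpreadCurve[]`) and the Hodge
# conjecture for abelian varieties of dimension `d` (`ClassTargets.HCAtDim d`), at EVERY fibre of EVERY compact pencil
# of abelian `d`-folds **`(j_s^*)⁻¹ N^p(𝒳_s) = N^p(𝒳) ⊔ ker j_s^*`** (Grothendieck's algebraic "partie fixe" in the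
# lattice language of part XVII-b) — so for `d = 4, 5` modulo Moonen–Zarhin 1999 and Markman 2025

HONEST FRAMING (page 1, verbatim): **research route, not a corollary; conditional on HC_CM plus one named
minimal statement.** Cell line: research route conditional on HC_CM; not a corollary; Q11.4-sentence-2 already
refuted in dim ≥ 3. Nothing in this file proves a case of the Hodge conjecture for an abelian variety; `SpreadCurve[]`
and the named facts in the signatures are BINDERS; the reduction item `CMToAbelian` (stmt-HodgeConjecture-16267) is
NOT closed here.

## Content

Part XIX-a's engine lifts a global class with rational `(p,p)` fibre restrictions (the binder of the nodes); the
lattice statement quantifies over ALL global classes `W` with `j_s^* W` algebraic. Part XVII-b's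
`mem_span_rational_of_map_fiberι_mem_algebraicClasses` (the comap of a rationally spanned subspace is rationally
spanned) reduces to RATIONAL `W`, which satisfy the binder by part XVII-a
(`fibrewiseHodge_of_isRationalClass_of_mem_algebraicClasses`). Results: `comap_le_sup_of_hcAtDim` (the lift `≤`),
`comap_eq_sup_of_hcAtDim` (equality, with part XVII-b's unconditional `≥`), and the instances `d = 4`
(`comap_eq_sup_of_relDim_four`, modulo `MoonenZarhin1999_codimTwoHodgeClasses_abelianFourfold` +
`Markman2025_weilClasses_algebraic_abelianFourfold` through `ClassTargets.hcAtDim_four_of_weilClassesFourfolds`) and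
`d = 5` (`comap_eq_sup_of_relDim_five`). Consumer: part XIX-b (graded hom ≡ num from `HC` of the fibres, through part
XVIII-c's exactness `(Num_t) ⟺ (L)_t`). EDGE LABELS: K[SpreadCurve] (+ the named facts in each signature). No `def`,
no `sorry`; axioms standard.

References: VoisinHodgeII2003 (§3.3.1, proof of Thm. 10.19); CharlesSchnell2014Notes (Prop. 11.3.5, Cor. 11.3.6,
Prop. 11.3.11); Milne2020HodgeClassesAV (Prop. 1, last line of the proof, p. 8); MoonenZarhin1999LowDim (Thms. 0.1–0.2);
Markman2025SecantWeil (Cor. 1.6.1).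
-/

noncomputable section

set_option linter.dupNamespace false

namespace Summit.HodgeConjecture.HodgeConjecture.Ring2.AbelianAll

open CategoryTheory AlgebraicGeometry
open Literature.AlgebraicGeometry Literature.AlgebraicGeometry.Motives
open Literature.AlgebraicGeometry.HodgeTheory
open Summit.HodgeConjecture.HodgeConjecture
open Summit.HodgeConjecture.HodgeConjecture.Ring2.ClassTargets (HCAtDim hcAtDim_four_of_weilClassesFourfolds
  hcAtDim_five_of_hcAtDim_four)

variable {𝒳 S : SchemeOver ℂ}

/-- `SpreadCurve[]` — part XIX-a's hypothesis shape (VERBATIM the body of the Literature named fact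
`HodgeTheory.spread_algebraicClasses_over_smoothCurve`: spreading fibrewise algebraic rational classes over a smooth
curve; Voisin II §3.3.1 and proof of Thm. 10.19, Charles–Schnell proof of Prop. 11.3.11). NOT vendored: no definition
is made here. [cite: VoisinHodgeII2003, §3.3.1 and §10.2.1, proof of Thm. 10.19] [cite: CharlesSchnell2014Notes, Prop. 11.3.11 (proof)] -/
local notation3 (prettyPrint := false) "SpreadCurve[]" =>
  ∀ ⦃d q : ℕ⦄ ⦃T W : SchemeOver ℂ⦄ (f : W ⟶ T),
    SmoothOfRelativeDimension 1 T.hom → IrreducibleSpace T.left → IsQuasiProjectiveOver W →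
    Flat f.left → IsProper f.left → 1 ≤ q → q ≤ d →
    ∀ S : Set T.left, IsClosed S → S ≠ Set.univ →
      (∀ t : ComplexPoints T, t.pt ∉ S → IsSmoothProjective d (fiberOver f t)) →
      ∀ c : complexBetti W (2 * q), IsRationalClass c →
        (∀ t : ComplexPoints T, t.pt ∉ S →
          complexBetti.map (fiberι f t) (2 * q) c ∈ algebraicClasses (fiberOver f t) q) →
        ∃ a : complexBetti W (2 * q), a ∈ algebraicClasses W q ∧ IsRationalClass a ∧
          ∃ S' : Set T.left, IsClosed S' ∧ S ⊆ S' ∧ S' ≠ Set.univ ∧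
            ∀ t : ComplexPoints T, t.pt ∉ S' →
              complexBetti.map (fiberι f t) (2 * q) (c - a) = 0

/-- **The lift at EVERY point from `HC` of the fibres**: granted `SpreadCurve[]`, on a compact pencil of abelian
`d`-folds with `HCAtDim d`, `(j_t^*)⁻¹ N^p(𝒳_t) ≤ N^p(𝒳) ⊔ ker j_t^*` for every `t` and every `p`. A class `W` with
`j_t^* W` algebraic lies in the `ℂ`-span of RATIONAL such classes (part XVII-b,
`mem_span_rational_of_map_fiberι_mem_algebraicClasses`); a rational one satisfies the fibrewise Hodge binder
(part XVII-a) and is lifted by part XIX-a's `exists_algebraic_lift_of_hcAtDim`.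
[cite: CharlesSchnell2014Notes, Prop. 11.3.5 and Cor. 11.3.6 (p. 494)] [cite: VoisinHodgeII2003, §3.3.1] -/
theorem comap_le_sup_of_hcAtDim (hSp : SpreadCurve[]) {d : ℕ} (h : HCAtDim d) {f : 𝒳 ⟶ S}
    (hf : IsCompactAbelianPencil f d) (p : ℕ) (t : ComplexPoints S) :
    (algebraicClasses (fiberOver f t) p).comap (complexBetti.map (fiberι f t) (2 * p)).hom ≤
      algebraicClasses 𝒳 p ⊔ LinearMap.ker (complexBetti.map (fiberι f t) (2 * p)).hom := by
  intro W hW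
  have hW' : complexBetti.map (fiberι f t) (2 * p) W ∈ algebraicClasses (fiberOver f t) p := hW
  have hspan := mem_span_rational_of_map_fiberι_mem_algebraicClasses hf hW'
  have hle : Submodule.span ℂ {W' : complexBetti 𝒳 (2 * p) | IsRationalClass W' ∧
      complexBetti.map (fiberι f t) (2 * p) W' ∈ algebraicClasses (fiberOver f t) p} ≤
      algebraicClasses 𝒳 p ⊔ LinearMap.ker (complexBetti.map (fiberι f t) (2 * p)).hom := by
    refine Submodule.span_le.2 ?_
    rintro W' ⟨hW'rat, hW'alg⟩
    obtain ⟨η, hη, hηW'⟩ := exists_algebraic_lift_of_hcAtDim hSp h hf W'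
      (fibrewiseHodge_of_isRationalClass_of_mem_algebraicClasses hf hW'rat hW'alg)
    change W' ∈ algebraicClasses 𝒳 p ⊔ LinearMap.ker (complexBetti.map (fiberι f t) (2 * p)).hom
    rw [show W' = η + (W' - η) by abel]
    refine Submodule.add_mem_sup hη ?_
    rw [LinearMap.mem_ker, map_sub, sub_eq_zero]
    exact (hηW' t).symm
  exact hle hspan

/-- **The algebraic fixed part in LATTICE form from `HC` of the fibres**: granted `SpreadCurve[]` and `HCAtDim d`,
`(j_s^*)⁻¹ N^p(𝒳_s) = N^p(𝒳) ⊔ ker j_s^*` at every fibre of every compact pencil of abelian `d`-folds (part XVII-b's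
`algebraicClasses_sup_ker_le_comap` is the unconditional inclusion `≥`).
[cite: Milne2020HodgeClassesAV, Prop. 1, last line of the proof (p. 8)] [cite: CharlesSchnell2014Notes, Cor. 11.3.6] -/
theorem comap_eq_sup_of_hcAtDim (hSp : SpreadCurve[]) {d : ℕ} (h : HCAtDim d) {f : 𝒳 ⟶ S}
    (hf : IsCompactAbelianPencil f d) (p : ℕ) (s : ComplexPoints S) :
    (algebraicClasses (fiberOver f s) p).comap (complexBetti.map (fiberι f s) (2 * p)).hom =
      algebraicClasses 𝒳 p ⊔ LinearMap.ker (complexBetti.map (fiberι f s) (2 * p)).hom :=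
  le_antisymm (comap_le_sup_of_hcAtDim hSp h hf p s) (algebraicClasses_sup_ker_le_comap hf p s)

/-- **`d = 4`: the algebraic fixed part in lattice form on every compact pencil of abelian FOURFOLDS**, modulo
`SpreadCurve[]`, Moonen–Zarhin 1999 Thm. 0.1 and Markman 2025 (`ClassTargets.hcAtDim_four_of_weilClassesFourfolds`).
[cite: MoonenZarhin1999LowDim, Thm. 0.1 with (1.4), (1.9)] [cite: Markman2025SecantWeil, Cor. 1.6.1]
[cite: Milne2020HodgeClassesAV, Prop. 1 (p. 7)] -/
theorem comap_eq_sup_of_relDim_four (hSp : SpreadCurve[])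
    (h01 : MoonenZarhin1999_codimTwoHodgeClasses_abelianFourfold)
    (hM : Markman2025_weilClasses_algebraic_abelianFourfold) {f : 𝒳 ⟶ S} (hf : IsCompactAbelianPencil f 4)
    (p : ℕ) (s : ComplexPoints S) :
    (algebraicClasses (fiberOver f s) p).comap (complexBetti.map (fiberι f s) (2 * p)).hom =
      algebraicClasses 𝒳 p ⊔ LinearMap.ker (complexBetti.map (fiberι f s) (2 * p)).hom :=
  comap_eq_sup_of_hcAtDim hSp (hcAtDim_four_of_weilClassesFourfolds h01 hM) hf p s

/-- **`d = 5`: the algebraic fixed part in lattice form on every compact pencil of abelian FIVEFOLDS**, modulo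
`SpreadCurve[]`, Moonen–Zarhin 1999 Thms. 0.1–0.2 and Markman 2025 (`ClassTargets.hcAtDim_five_of_hcAtDim_four`).
[cite: MoonenZarhin1999LowDim, Thm. 0.2 with (2.8), §5 (5.11)] [cite: Markman2025SecantWeil, Cor. 1.6.1]
[cite: Milne2020HodgeClassesAV, Prop. 1 (p. 7)] -/
theorem comap_eq_sup_of_relDim_five (hSp : SpreadCurve[])
    (h01 : MoonenZarhin1999_codimTwoHodgeClasses_abelianFourfold)
    (h02 : MoonenZarhin1999_codimTwoHodgeClasses_abelianFivefold)
    (hM : Markman2025_weilClasses_algebraic_abelianFourfold) {f : 𝒳 ⟶ S} (hf : IsCompactAbelianPencil f 5)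
    (p : ℕ) (s : ComplexPoints S) :
    (algebraicClasses (fiberOver f s) p).comap (complexBetti.map (fiberι f s) (2 * p)).hom =
      algebraicClasses 𝒳 p ⊔ LinearMap.ker (complexBetti.map (fiberι f s) (2 * p)).hom :=
  comap_eq_sup_of_hcAtDim hSp (hcAtDim_five_of_hcAtDim_four h02 (hcAtDim_four_of_weilClassesFourfolds h01 hM)) hf p s

end Summit.HodgeConjecture.HodgeConjecture.Ring2.AbelianAll

end
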